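import Summits.ValiantsHypothesis.ValiantsHypothesis.Theorems.GrenetZeonDualUnipotentThreeHalvesHeavyTopInvariantFlag
import Summits.ValiantsHypothesis.ValiantsHypothesis.Theorems.GrenetZeonDualUnipotentThreeHalvesHeavyTopKrylovSeedDefs

/-!
# `GrenetZeon.DualUnipotentThreeHalves` (stmt-ValiantsHypothesis-24318), LINE α `krylov_seed`: the BLOCK-MASS inequality of a
# heavy-top pencil, and the research stub S1b `FatBlockWeightLaw` is EQUIVALENT to C⁺ `UniformWeightLaw` (critic price L-4, in kernel)

Lead prover val-port-2 g3 (skeleton `Cruxes/DualUnipotentThreeHalves/Lines/krylov_seed.lean`, rev 3a @e221367c28d8: one `sorry`,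
S1b `stub_fatBlockWeightLaw : FatBlockWeightLaw`, whose extra hypothesis is `¬ SmallBlockStructure n m N ⌊√n⌋`).  The critic of record
(val-idea-crit-7 g2, VERDICT #9 price L-4 and VERDICT #11 remark (a)) observed that this hypothesis is FREE: it follows from the
heavy-top hypothesis deep in the regime.  This file proves it.

* `heavyTop_blockMass` — if the affine nilpotent pencil is block-upper after a constant change of basis `P` for a level function
  `lvl < p`, and every trace-orthogonal direction space (`RadOrth`) has dimension `≤ B`, then `n² ≤ B + Σ_{t<p} C(#{lvl = t}, 2)`.
  Proof: `K_rad := {v : every diagonal block of P·N_lin(v)·P⁻¹ vanishes}` IS trace-orthogonal to the pencil algebra (conjugates of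
  members of `𝒜(N)` are block-upper, and the trace of «block-upper with zero diagonal blocks» × «block-upper» vanishes), so
  `dim K_rad ≤ B`; and `codim K_rad ≤ Σ_t C(#block_t, 2)` by Gerstenhaber on each diagonal block space (the count of ✓
  `HeavyTopInvariantFlag.flagCheap_of_invariant_levels`, verbatim).
* `two_sq_le_of_smallBlocks` — with all blocks of size `≤ s`: `2n² ≤ 2B + (s − 1)·m` (since `Σ_t #block_t = m`); equivalently the
  largest block has `(k_max − 1)·m ≥ 2(n² − B)` (crit-7's «k_max ≥ 2(n² − 16m√n − 16n)/m»).
* `not_smallBlocks_sqrt_of_heavyTop` — for `n ≥ 49` and `1089·m² < n³`, a heavy-top (`B = 16m√n + 16n`) affine nilpotent pencil has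
  NO small-block structure at scale `⌊√n⌋` (the line's `¬ SmallBlockStructure n m N (Nat.sqrt n)`, δ-unfolded): the S1a∘S1c branch of the
  line never fires where S1b must work.
* ★ `uniformWeightLaw_of_fatBlockLaw` / `fatBlockLaw_of_uniformWeightLaw` — the line's `FatBlockWeightLaw` (δ-unfolded) and C⁺
  `UniformWeightLaw` (✓ `…HeavyTopKrylovSeedDefs`) imply each other: **the fat irreducible factor LOCATES the open case, it is not a
  lever** (crit-7 L-4), now a kernel theorem; the line's rev 4 records `FatBlockWeightLaw ↔ UniformWeightLaw` by name.

Honest framing.  Bookkeeping for the LAW-tier stub S1b (`--supports stmt-ValiantsHypothesis-24318 --as helper`); nothing here proves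
S1b, C⁺, R2 `HeavyTopLaw`, the crux, 8062 or `VP ≠ VNP` — all OPEN / NOT proved.  No definitions, no named facts.
[folklore + Gerstenhaber 1958 via ✓ `Literature…finrank_le_choose_two`; crit-7 g2 V09 §L-4 / V11 (a)]
-/

-- single-conjunct layout: Sub = Summit, duplicated namespace component intended (the name is mandated)
set_option linter.dupNamespace false
set_option autoImplicit false

noncomputable section

namespace Summit.ValiantsHypothesis.ValiantsHypothesis.Theorems.GrenetZeon.KrylovSeed

open MvPolynomial Matrix
open scoped BigOperators
open Summit.ValiantsHypothesis.ValiantsHypothesis.Cruxes.TwoDimCoefficients.DimTwoCases (AffMat IsAffine)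
open Summit.ValiantsHypothesis.ValiantsHypothesis.Theorems.GrenetZeon.RadicalSplit
  (pencilAlg linPart RadOrth exists_topMap_linPart linPart_pow_eq_zero)
open Summit.ValiantsHypothesis.ValiantsHypothesis.Theorems.GrenetZeon.HeavyTopInvariantFlag
  (blockUpper_mul isNilpotent_reindex_toBlock)
open Literature.LinearAlgebra.Matrix.GerstenhaberNilpotentSubspace (finrank_le_choose_two)

variable {m : ℕ}

/-! ## §1 Block-upper bookkeeping: evaluations, the pencil algebra, traces -/

/-- If the PENCIL is block-upper after `P` (as a polynomial matrix), so is every VALUE `P·N(x)·P⁻¹`. [folklore] -/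
theorem blockUpper_eval_of_pencil {n : ℕ} (N : AffMat n m) (P : (Matrix (Fin m) (Fin m) ℂ)ˣ) (lvl : Fin m → ℕ)
    (hblock : ∀ i j : Fin m, lvl i < lvl j →
      ((P : Matrix (Fin m) (Fin m) ℂ).map C * N * (↑P⁻¹ : Matrix (Fin m) (Fin m) ℂ).map C :
        Matrix (Fin m) (Fin m) (MvPolynomial (Fin n × Fin n) ℂ)) i j = 0)
    (x : Fin n × Fin n → ℂ) :
    ∀ i j : Fin m, lvl i < lvl j →
      ((P : Matrix (Fin m) (Fin m) ℂ) * N.map (MvPolynomial.eval x) * (↑P⁻¹ : Matrix (Fin m) (Fin m) ℂ)) i j = 0 := by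
  intro i j hij
  have h := congr_arg (MvPolynomial.eval x) (hblock i j hij)
  rw [map_zero] at h
  have hev : MvPolynomial.eval x ((((P : Matrix (Fin m) (Fin m) ℂ)).map C * N * (↑P⁻¹ : Matrix (Fin m) (Fin m) ℂ).map C :
      Matrix (Fin m) (Fin m) (MvPolynomial (Fin n × Fin n) ℂ)) i j) =
      (((((P : Matrix (Fin m) (Fin m) ℂ)).map C * N * (↑P⁻¹ : Matrix (Fin m) (Fin m) ℂ).map C).map
        (MvPolynomial.eval x)) i j) := rfl
  rw [hev, Matrix.map_mul, Matrix.map_mul, Matrix.map_map, Matrix.map_map] at h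
  have hC : ((MvPolynomial.eval x : MvPolynomial (Fin n × Fin n) ℂ → ℂ) ∘ (C : ℂ → MvPolynomial (Fin n × Fin n) ℂ)) = id :=
    funext fun a => by simp
  rw [hC, Matrix.map_id, Matrix.map_id] at h
  exact h

/-- **Conjugates of members of the pencil algebra are block-upper** whenever the pencil is: the block-upper matrices (for `lvl`,
after `P`) form a subalgebra containing every value `N(x)`, hence `𝒜(N)`. [folklore] -/
theorem blockUpper_conj_of_mem_pencilAlg {n : ℕ} (N : AffMat n m) (P : (Matrix (Fin m) (Fin m) ℂ)ˣ) (lvl : Fin m → ℕ)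
    (hblock : ∀ i j : Fin m, lvl i < lvl j →
      ((P : Matrix (Fin m) (Fin m) ℂ).map C * N * (↑P⁻¹ : Matrix (Fin m) (Fin m) ℂ).map C :
        Matrix (Fin m) (Fin m) (MvPolynomial (Fin n × Fin n) ℂ)) i j = 0)
    (b : Matrix (Fin m) (Fin m) ℂ) (hb : b ∈ pencilAlg N) :
    ∀ i j : Fin m, lvl i < lvl j → ((P : Matrix (Fin m) (Fin m) ℂ) * b * (↑P⁻¹ : Matrix (Fin m) (Fin m) ℂ)) i j = 0 := by
  let B : Subalgebra ℂ (Matrix (Fin m) (Fin m) ℂ) :=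
    { carrier := {b | ∀ i j : Fin m, lvl i < lvl j →
        ((P : Matrix (Fin m) (Fin m) ℂ) * b * (↑P⁻¹ : Matrix (Fin m) (Fin m) ℂ)) i j = 0}
      mul_mem' := by
        intro a b ha hb i j hij
        have hab : (P : Matrix (Fin m) (Fin m) ℂ) * (a * b) * (↑P⁻¹ : Matrix (Fin m) (Fin m) ℂ) =
            ((P : Matrix (Fin m) (Fin m) ℂ) * a * (↑P⁻¹ : Matrix (Fin m) (Fin m) ℂ)) *
              ((P : Matrix (Fin m) (Fin m) ℂ) * b * (↑P⁻¹ : Matrix (Fin m) (Fin m) ℂ)) := by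
          simp only [Matrix.mul_assoc]
          rw [Units.inv_mul_cancel_left]
        rw [hab]
        exact blockUpper_mul lvl _ _ ha hb i j hij
      one_mem' := by
        intro i j hij
        rw [Matrix.mul_one, Units.mul_inv, Matrix.one_apply, if_neg]
        intro h; rw [h] at hij; exact lt_irrefl _ hij
      add_mem' := by
        intro a b ha hb i j hij
        rw [Matrix.mul_add, Matrix.add_mul, Matrix.add_apply, ha i j hij, hb i j hij, add_zero]
      zero_mem' := by
        intro i j _
        rw [Matrix.mul_zero, Matrix.zero_mul, Matrix.zero_apply]
      algebraMap_mem' := by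
        intro r i j hij
        rw [Algebra.algebraMap_eq_smul_one, Matrix.mul_smul, Matrix.smul_mul, Matrix.smul_apply, Matrix.mul_one,
          Units.mul_inv, Matrix.one_apply, if_neg, smul_zero]
        intro h; rw [h] at hij; exact lt_irrefl _ hij }
  have hle : pencilAlg N ≤ B := by
    refine Algebra.adjoin_le ?_
    rintro _ ⟨x, rfl⟩
    exact blockUpper_eval_of_pencil N P lvl hblock x
  exact hle hb

/-- The trace of «block-upper with ZERO diagonal blocks» times «block-upper» vanishes. [folklore] -/
theorem trace_mul_eq_zero_of_blockUpper (lvl : Fin m → ℕ) (A B : Matrix (Fin m) (Fin m) ℂ)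
    (hA : ∀ i j, lvl i < lvl j → A i j = 0) (hA₀ : ∀ i j, lvl i = lvl j → A i j = 0)
    (hB : ∀ i j, lvl i < lvl j → B i j = 0) : Matrix.trace (A * B) = 0 := by
  rw [Matrix.trace]
  refine Finset.sum_eq_zero fun i _ => ?_
  rw [Matrix.diag_apply, Matrix.mul_apply]
  refine Finset.sum_eq_zero fun l _ => ?_
  rcases lt_trichotomy (lvl i) (lvl l) with h | h | h
  · rw [hA i l h, zero_mul]
  · rw [hA₀ i l h, zero_mul]
  · rw [hB l i h, mul_zero]

/-! ## §2 The block-mass inequality -/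

/-- ★ **BLOCK MASS OF A HEAVY-TOP PENCIL.**  Let the affine nilpotent pencil `N` be block-upper after the constant change of basis `P`
for the level function `lvl` with `p` levels, and suppose every direction space trace-orthogonal to the pencil algebra has dimension
`≤ B` (the heavy-top hypothesis of R2 has `B = 16m√n + 16n`).  Then `n² ≤ B + Σ_{t<p} C(#{i : lvl i = t}, 2)`.
The direction space `K_rad = {v : all diagonal blocks of P·N_lin(v)·P⁻¹ vanish}` is `RadOrth` and has codimension at most the total
dimension of the diagonal block spaces, each a nilpotent linear space bounded by Gerstenhaber. [folklore + Gerstenhaber 1958; crit-7 g2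
V11 (a)] -/
theorem heavyTop_blockMass {n : ℕ} (N : AffMat n m) (hN : IsAffine N) (hnil : N ^ m = 0) (B : ℕ)
    (htop : ∀ K : Submodule ℂ (Fin n × Fin n → ℂ), RadOrth n m N K → Module.finrank ℂ K ≤ B)
    (P : (Matrix (Fin m) (Fin m) ℂ)ˣ) (lvl : Fin m → ℕ) (p : ℕ) (hlvl : ∀ i, lvl i < p)
    (hblock : ∀ i j : Fin m, lvl i < lvl j →
      ((P : Matrix (Fin m) (Fin m) ℂ).map C * N * (↑P⁻¹ : Matrix (Fin m) (Fin m) ℂ).map C :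
        Matrix (Fin m) (Fin m) (MvPolynomial (Fin n × Fin n) ℂ)) i j = 0) :
    n ^ 2 ≤ B + ∑ t ∈ Finset.range p, (Fintype.card {i : Fin m // lvl i = t}).choose 2 := by
  classical
  -- the conjugated top map
  obtain ⟨T₀, hT₀⟩ := exists_topMap_linPart N hN
  let T : (Fin n × Fin n → ℂ) →ₗ[ℂ] Matrix (Fin m) (Fin m) ℂ :=
    (LinearMap.mulRight ℂ (↑P⁻¹ : Matrix (Fin m) (Fin m) ℂ)) ∘ₗ
      (LinearMap.mulLeft ℂ (P : Matrix (Fin m) (Fin m) ℂ)) ∘ₗ T₀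
  have hT : ∀ v, T v = (P : Matrix (Fin m) (Fin m) ℂ) * linPart N v * (↑P⁻¹ : Matrix (Fin m) (Fin m) ℂ) := by
    intro v
    simp only [T, LinearMap.coe_comp, Function.comp_apply, LinearMap.mulLeft_apply, LinearMap.mulRight_apply, hT₀]
  -- every conjugated top is block upper and nilpotent
  have heval := blockUpper_eval_of_pencil N P lvl hblock
  have hTblock : ∀ v i j, lvl i < lvl j → T v i j = 0 := by
    intro v i j hij
    rw [hT, show linPart N v = N.map (MvPolynomial.eval v) - N.map (MvPolynomial.eval 0) from rfl,
      Matrix.mul_sub, Matrix.sub_mul, Matrix.sub_apply, heval v i j hij, heval 0 i j hij, sub_zero]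
  have hTnil : ∀ v, T v ^ m = 0 := by
    intro v
    rw [hT, Units.conj_pow, linPart_pow_eq_zero N hN hnil v, Matrix.mul_zero, Matrix.zero_mul]
  -- the block spaces: sizes, reindexing, and the diagonal-block maps
  let sz : Fin p → ℕ := fun t => Fintype.card {i : Fin m // lvl i = (t : ℕ)}
  let e : ∀ t : Fin p, {i : Fin m // lvl i = (t : ℕ)} ≃ Fin (sz t) := fun t => Fintype.equivFin _
  let blk : ∀ t : Fin p, Matrix (Fin m) (Fin m) ℂ →ₗ[ℂ] Matrix (Fin (sz t)) (Fin (sz t)) ℂ := fun t =>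
    (Matrix.reindexAlgEquiv ℂ ℂ (e t)).toLinearEquiv.toLinearMap ∘ₗ
      { toFun := fun A => A.toBlock (fun i => lvl i = (t : ℕ)) (fun i => lvl i = (t : ℕ))
        map_add' := fun A B => rfl
        map_smul' := fun c A => rfl }
  have hblk : ∀ (t : Fin p) (A : Matrix (Fin m) (Fin m) ℂ),
      blk t A = Matrix.reindexAlgEquiv ℂ ℂ (e t) (A.toBlock (fun i => lvl i = (t : ℕ)) (fun i => lvl i = (t : ℕ))) :=
    fun t A => rfl
  let Φ : (Fin n × Fin n → ℂ) →ₗ[ℂ] (∀ t : Fin p, Matrix (Fin (sz t)) (Fin (sz t)) ℂ) :=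
    LinearMap.pi fun t => blk t ∘ₗ T
  have hΦ : ∀ v t, Φ v t = blk t (T v) := fun v t => rfl
  -- Gerstenhaber on each block space
  have hD : ∀ t : Fin p, Module.finrank ℂ (LinearMap.range (blk t ∘ₗ T)) ≤ (sz t).choose 2 := by
    intro t
    refine finrank_le_choose_two (sz t) _ fun A hA => ?_
    obtain ⟨v, rfl⟩ := LinearMap.mem_range.1 hA
    rw [LinearMap.comp_apply, hblk]
    exact isNilpotent_reindex_toBlock lvl (T v) (hTblock v) (hTnil v) (t : ℕ) (e t)
  -- the range of `Φ` embeds into the product of the block spaces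
  have hrange : Module.finrank ℂ (LinearMap.range Φ) ≤ ∑ t : Fin p, (sz t).choose 2 := by
    let ι : LinearMap.range Φ →ₗ[ℂ] (∀ t : Fin p, LinearMap.range (blk t ∘ₗ T)) :=
      LinearMap.pi fun t =>
        { toFun := fun x => ⟨x.1 t, by
            obtain ⟨v, hv⟩ := LinearMap.mem_range.1 x.2
            exact LinearMap.mem_range.2 ⟨v, by rw [← hv]; rfl⟩⟩
          map_add' := fun x y => rfl
          map_smul' := fun c x => rfl }
    have hι : Function.Injective ι := by
      intro x y hxy
      apply Subtype.ext
      funext t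
      have := congr_arg (fun f => ((f t : LinearMap.range (blk t ∘ₗ T)) : Matrix (Fin (sz t)) (Fin (sz t)) ℂ))
        hxy
      exact this
    calc Module.finrank ℂ (LinearMap.range Φ)
        ≤ Module.finrank ℂ (∀ t : Fin p, LinearMap.range (blk t ∘ₗ T)) :=
          LinearMap.finrank_le_finrank_of_injective hι
      _ = ∑ t : Fin p, Module.finrank ℂ (LinearMap.range (blk t ∘ₗ T)) := Module.finrank_pi_fintype ℂ
      _ ≤ ∑ t : Fin p, (sz t).choose 2 := Finset.sum_le_sum fun t _ => hD t
  have hsum : ∑ t : Fin p, (sz t).choose 2 = ∑ t ∈ Finset.range p, (Fintype.card {i : Fin m // lvl i = t}).choose 2 :=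
    Fin.sum_univ_eq_sum_range (fun t => (Fintype.card {i : Fin m // lvl i = t}).choose 2) p
  -- `K_rad = ker Φ` is trace-orthogonal to the pencil algebra
  have hrad : RadOrth n m N (LinearMap.ker Φ) := by
    intro v hv b hb
    have hv0 : Φ v = 0 := LinearMap.mem_ker.mp hv
    have hA₀ : ∀ i j : Fin m, lvl i = lvl j → T v i j = 0 := by
      intro i j he
      have hb' : blk ⟨lvl i, hlvl i⟩ (T v) = 0 := by rw [← hΦ, hv0]; rfl
      rw [hblk, map_eq_zero_iff _ (Matrix.reindexAlgEquiv ℂ ℂ _).injective] at hb'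
      have h0 := congr_fun (congr_fun hb' ⟨i, rfl⟩) ⟨j, he.symm⟩
      rwa [Matrix.toBlock_apply, Matrix.zero_apply] at h0
    have hbB := blockUpper_conj_of_mem_pencilAlg N P lvl hblock b hb
    have hconj : (P : Matrix (Fin m) (Fin m) ℂ) * (linPart N v * b) * (↑P⁻¹ : Matrix (Fin m) (Fin m) ℂ) =
        T v * ((P : Matrix (Fin m) (Fin m) ℂ) * b * (↑P⁻¹ : Matrix (Fin m) (Fin m) ℂ)) := by
      rw [hT]
      simp only [Matrix.mul_assoc]
      rw [Units.inv_mul_cancel_left]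
    calc Matrix.trace (linPart N v * b)
        = Matrix.trace ((P : Matrix (Fin m) (Fin m) ℂ) * (linPart N v * b) * (↑P⁻¹ : Matrix (Fin m) (Fin m) ℂ)) := by
          rw [Matrix.trace_units_conj]
      _ = Matrix.trace (T v * ((P : Matrix (Fin m) (Fin m) ℂ) * b * (↑P⁻¹ : Matrix (Fin m) (Fin m) ℂ))) := by rw [hconj]
      _ = 0 := trace_mul_eq_zero_of_blockUpper lvl _ _ (hTblock v) hA₀ hbB
  -- count
  have hK := htop _ hrad
  have h1 := LinearMap.finrank_range_add_finrank_ker Φ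
  have h3 : Module.finrank ℂ (Fin n × Fin n → ℂ) = n * n := by
    rw [Module.finrank_fintype_fun_eq_card, Fintype.card_prod, Fintype.card_fin]
  have h4 : n ^ 2 = n * n := sq n
  rw [← hsum, h4]
  omega

/-- **SMALL BLOCKS ARE IMPOSSIBLE FOR FAT HEAVY TOPS (quantitative form).**  If all blocks have size `≤ s` then
`2n² ≤ 2B + (s − 1)·m` (sum `C(k_t,2)·2 = k_t(k_t − 1) ≤ k_t(s − 1)` over `Σ_t k_t = m`).  Read contrapositively: the largest block of
ANY block-upper form of a heavy-top pencil has `(k_max − 1)·m ≥ 2(n² − B)`. [folklore; crit-7 g2 V11 (a)] -/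
theorem two_sq_le_of_smallBlocks {n : ℕ} (N : AffMat n m) (hN : IsAffine N) (hnil : N ^ m = 0) (B : ℕ)
    (htop : ∀ K : Submodule ℂ (Fin n × Fin n → ℂ), RadOrth n m N K → Module.finrank ℂ K ≤ B)
    (P : (Matrix (Fin m) (Fin m) ℂ)ˣ) (lvl : Fin m → ℕ) (p : ℕ) (hlvl : ∀ i, lvl i < p)
    (hblock : ∀ i j : Fin m, lvl i < lvl j →
      ((P : Matrix (Fin m) (Fin m) ℂ).map C * N * (↑P⁻¹ : Matrix (Fin m) (Fin m) ℂ).map C :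
        Matrix (Fin m) (Fin m) (MvPolynomial (Fin n × Fin n) ℂ)) i j = 0)
    (s : ℕ) (hsmall : ∀ t, t < p → (Finset.univ.filter fun i => lvl i = t).card ≤ s) :
    2 * n ^ 2 ≤ 2 * B + (s - 1) * m := by
  classical
  have hmass := heavyTop_blockMass N hN hnil B htop P lvl p hlvl hblock
  have hcard : ∀ t, Fintype.card {i : Fin m // lvl i = t} = (Finset.univ.filter fun i => lvl i = t).card :=
    fun t => Fintype.card_subtype _
  have hfib : ∑ t ∈ Finset.range p, (Finset.univ.filter fun i : Fin m => lvl i = t).card = m := by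
    have h := Finset.card_eq_sum_card_fiberwise (f := lvl) (s := (Finset.univ : Finset (Fin m))) (t := Finset.range p)
      (fun i _ => Finset.mem_coe.mpr (Finset.mem_range.mpr (hlvl i)))
    rw [Finset.card_univ, Fintype.card_fin] at h
    exact h.symm
  have hle : (∑ t ∈ Finset.range p, (Fintype.card {i : Fin m // lvl i = t}).choose 2) * 2 ≤ (s - 1) * m := by
    calc (∑ t ∈ Finset.range p, (Fintype.card {i : Fin m // lvl i = t}).choose 2) * 2
        = ∑ t ∈ Finset.range p, (Fintype.card {i : Fin m // lvl i = t}).choose 2 * 2 := Finset.sum_mul _ _ _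
      _ ≤ ∑ t ∈ Finset.range p, (s - 1) * (Finset.univ.filter fun i : Fin m => lvl i = t).card := by
          refine Finset.sum_le_sum fun t ht => ?_
          rw [Nat.choose_two_right, Nat.div_mul_cancel (Nat.even_mul_pred_self _).two_dvd, hcard, mul_comm]
          exact Nat.mul_le_mul_right _ (Nat.sub_le_sub_right (hsmall t (Finset.mem_range.mp ht)) 1)
      _ = (s - 1) * ∑ t ∈ Finset.range p, (Finset.univ.filter fun i : Fin m => lvl i = t).card :=
          (Finset.mul_sum _ _ _).symm
      _ = (s - 1) * m := by rw [hfib]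
  omega

/-! ## §3 In the regime, heavy-top pencils have NO small-block structure at scale `⌊√n⌋`; S1b ⟺ C⁺ -/

/-- **`¬ SmallBlockStructure n m N ⌊√n⌋` IS AUTOMATIC** (the line's definition δ-unfolded): for `n ≥ 49` and `1089·m² < n³`, an affine
nilpotent heavy-top pencil (`dim K ≤ 16m√n + 16n` for every `RadOrth K`) admits NO constant change of basis making it block-upper with
all blocks of size `≤ ⌊√n⌋`.  (Arithmetic: `33m < n(⌊√n⌋ + 1)`, so `2n² ≤ 32m⌊√n⌋ + 32n + (⌊√n⌋ − 1)m < n² + n⌊√n⌋ + 32n`, i.e.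
`n < ⌊√n⌋ + 32`, impossible for `n ≥ 49`.) [this file] -/
theorem not_smallBlocks_sqrt_of_heavyTop {n : ℕ} (hn : 49 ≤ n) (hreg : 1089 * m ^ 2 < n ^ 3)
    (N : AffMat n m) (hN : IsAffine N) (hnil : N ^ m = 0)
    (htop : ∀ K : Submodule ℂ (Fin n × Fin n → ℂ), RadOrth n m N K →
      Module.finrank ℂ K ≤ 16 * m * Nat.sqrt n + 16 * n) :
    ¬ ∃ (P : (Matrix (Fin m) (Fin m) ℂ)ˣ) (L : ℕ) (lvl : Fin m → ℕ), (∀ i, lvl i < L) ∧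
      (∀ i j : Fin m, lvl i < lvl j →
        ((P : Matrix (Fin m) (Fin m) ℂ).map C * N * (↑P⁻¹ : Matrix (Fin m) (Fin m) ℂ).map C :
          Matrix (Fin m) (Fin m) (MvPolynomial (Fin n × Fin n) ℂ)) i j = 0) ∧
      (∀ t, t < L → (Finset.univ.filter fun i => lvl i = t).card ≤ Nat.sqrt n) := by
  rintro ⟨P, L, lvl, hlvl, hblock, hsmall⟩
  have h := two_sq_le_of_smallBlocks N hN hnil _ htop P lvl L hlvl hblock (Nat.sqrt n) hsmall
  -- `r = ⌊√n⌋ = k + 1` with `k ≥ 6`, `(k+1)² ≤ n < (k+2)²`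
  have hr7 : 7 ≤ Nat.sqrt n := Nat.le_sqrt.mpr (le_trans (by norm_num) hn)
  obtain ⟨k, hk⟩ : ∃ k, Nat.sqrt n = k + 1 := ⟨Nat.sqrt n - 1, by omega⟩
  have hk6 : 6 ≤ k := by omega
  have hrr : (k + 1) * (k + 1) ≤ n := by rw [← hk]; exact Nat.sqrt_le n
  have hlt : n < (k + 2) * (k + 2) := by
    have := Nat.lt_succ_sqrt n
    rw [hk] at this
    exact this
  rw [hk, Nat.add_sub_cancel] at h
  -- `33 m < n (k+2)` from `(33m)² = 1089 m² < n³ ≤ n² (k+2)²`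
  have hsq : (33 * m) ^ 2 < (n * (k + 2)) ^ 2 := by
    calc (33 * m) ^ 2 = 1089 * m ^ 2 := by ring
      _ < n ^ 3 := hreg
      _ = n ^ 2 * n := by ring
      _ ≤ n ^ 2 * ((k + 2) * (k + 2)) := Nat.mul_le_mul_left _ hlt.le
      _ = (n * (k + 2)) ^ 2 := by ring
  have hm33 : 33 * m < n * (k + 2) := (Nat.pow_lt_pow_iff_left two_ne_zero).mp hsq
  -- multiply by `k+1` and compare with `h`
  have h33r : 33 * m * (k + 1) < n * (k + 2) * (k + 1) := Nat.mul_lt_mul_of_pos_right hm33 (Nat.succ_pos k)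
  have hnk : n * (k + 2) * (k + 1) ≤ n * n + n * (k + 1) := by
    have : n * (k + 2) * (k + 1) = n * ((k + 1) * (k + 1)) + n * (k + 1) := by ring
    rw [this]
    exact Nat.add_le_add_right (Nat.mul_le_mul_left _ hrr) _
  have h2 : 2 * n ^ 2 ≤ 33 * m * (k + 1) + 32 * n := by
    have : 2 * (16 * m * (k + 1) + 16 * n) + k * m ≤ 33 * m * (k + 1) + 32 * n := by nlinarith
    exact le_trans h this
  have h5 : n * n < n * (k + 33) := by nlinarith
  have h6 : n < k + 33 := Nat.lt_of_mul_lt_mul_left h5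
  nlinarith

/-- ★ **S1b ⟹ C⁺.**  The line's research stub `FatBlockWeightLaw` (δ-unfolded: C⁺ restricted to pencils with NO small-block structure at
scale `⌊√n⌋`) implies C⁺ `UniformWeightLaw` outright: enlarge the constants to `C₀ ≥ 1089`, `n₀ ≥ 49`; then the restriction is vacuous
by `not_smallBlocks_sqrt_of_heavyTop`.  So the fat irreducible factor LOCATES the open case; it is not a lever (crit-7 g2, price L-4).
[this file] -/
theorem uniformWeightLaw_of_fatBlockLaw
    (h : ∃ C₀ n₀ : ℕ, ∀ n ≥ n₀, ∀ m : ℕ, C₀ * m ^ 2 < n ^ 3 → ∀ N : AffMat n m, IsAffine N → N ^ m = 0 →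
      (∀ K : Submodule ℂ (Fin n × Fin n → ℂ), RadOrth n m N K →
        Module.finrank ℂ K ≤ 16 * m * Nat.sqrt n + 16 * n) →
      (¬ ∃ (P : (Matrix (Fin m) (Fin m) ℂ)ˣ) (L : ℕ) (lvl : Fin m → ℕ), (∀ i, lvl i < L) ∧
        (∀ i j : Fin m, lvl i < lvl j →
          ((P : Matrix (Fin m) (Fin m) ℂ).map C * N * (↑P⁻¹ : Matrix (Fin m) (Fin m) ℂ).map C :
            Matrix (Fin m) (Fin m) (MvPolynomial (Fin n × Fin n) ℂ)) i j = 0) ∧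
        (∀ t, t < L → (Finset.univ.filter fun i => lvl i = t).card ≤ Nat.sqrt n)) →
      WeightThin n m N) :
    UniformWeightLaw := by
  obtain ⟨Cb, nb, hb⟩ := h
  refine ⟨max Cb 1089, max nb 49, fun n hn m hreg N hN hnil htop => ?_⟩
  have hnb : nb ≤ n := le_trans (le_max_left _ _) hn
  have hn49 : 49 ≤ n := le_trans (le_max_right _ _) hn
  have hregb : Cb * m ^ 2 < n ^ 3 := lt_of_le_of_lt (Nat.mul_le_mul_right _ (le_max_left _ _)) hreg
  have hreg' : 1089 * m ^ 2 < n ^ 3 := lt_of_le_of_lt (Nat.mul_le_mul_right _ (le_max_right _ _)) hreg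
  exact hb n hnb m hregb N hN hnil htop (not_smallBlocks_sqrt_of_heavyTop hn49 hreg' N hN hnil htop)

/-- **C⁺ ⟹ S1b** (drop the extra hypothesis). [definitional] -/
theorem fatBlockLaw_of_uniformWeightLaw (h : UniformWeightLaw) :
    ∃ C₀ n₀ : ℕ, ∀ n ≥ n₀, ∀ m : ℕ, C₀ * m ^ 2 < n ^ 3 → ∀ N : AffMat n m, IsAffine N → N ^ m = 0 →
      (∀ K : Submodule ℂ (Fin n × Fin n → ℂ), RadOrth n m N K →
        Module.finrank ℂ K ≤ 16 * m * Nat.sqrt n + 16 * n) →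
      (¬ ∃ (P : (Matrix (Fin m) (Fin m) ℂ)ˣ) (L : ℕ) (lvl : Fin m → ℕ), (∀ i, lvl i < L) ∧
        (∀ i j : Fin m, lvl i < lvl j →
          ((P : Matrix (Fin m) (Fin m) ℂ).map C * N * (↑P⁻¹ : Matrix (Fin m) (Fin m) ℂ).map C :
            Matrix (Fin m) (Fin m) (MvPolynomial (Fin n × Fin n) ℂ)) i j = 0) ∧
        (∀ t, t < L → (Finset.univ.filter fun i => lvl i = t).card ≤ Nat.sqrt n)) →
      WeightThin n m N := by
  obtain ⟨C₀, n₀, h⟩ := h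
  exact ⟨C₀, n₀, fun n hn m hreg N hN hnil htop _ => h n hn m hreg N hN hnil htop⟩

/-! ## §4 (rev 2) The LOCATION datum in `∃`-form -/

/-- **THE FAT LEVEL (location datum for attackers of S1b).**  In ANY block-upper form (after a constant `P`, levels `lvl < p`) of an
affine nilpotent pencil all of whose trace-orthogonal direction spaces have dimension `≤ B`, some level `t < p` is FAT:
`2·(n² − B) ≤ (#{i : lvl i = t} − 1)·m` (for `m ≥ 1`; truncated subtraction, so the statement is void when `B ≥ n²`).  Applied to the
Jordan–Hölder form of ✓ `exists_fat_irreducible_block` with `B = 16m√n + 16n`: the pencil has ONE IRREDUCIBLE diagonal block of size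
`k ≥ 1 + 2(n² − 16m√n − 16n)/m` — this, not «some block `> ⌊√n⌋`», is what the research stub S1b (≡ C⁺) hands its attacker.
[this file; crit-7 g2 V11 (a) / 21:33:02Z] -/
theorem exists_fat_level_of_heavyTop {n : ℕ} (N : AffMat n m) (hN : IsAffine N) (hnil : N ^ m = 0) (B : ℕ)
    (htop : ∀ K : Submodule ℂ (Fin n × Fin n → ℂ), RadOrth n m N K → Module.finrank ℂ K ≤ B)
    (P : (Matrix (Fin m) (Fin m) ℂ)ˣ) (lvl : Fin m → ℕ) (p : ℕ) (hlvl : ∀ i, lvl i < p)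
    (hblock : ∀ i j : Fin m, lvl i < lvl j →
      ((P : Matrix (Fin m) (Fin m) ℂ).map C * N * (↑P⁻¹ : Matrix (Fin m) (Fin m) ℂ).map C :
        Matrix (Fin m) (Fin m) (MvPolynomial (Fin n × Fin n) ℂ)) i j = 0)
    (hm : 0 < m) :
    ∃ t, t < p ∧ 2 * (n ^ 2 - B) ≤ (Fintype.card {i : Fin m // lvl i = t} - 1) * m := by
  classical
  have hne : (Finset.range p).Nonempty := ⟨lvl ⟨0, hm⟩, Finset.mem_range.mpr (hlvl _)⟩
  obtain ⟨t₀, ht₀, hmax⟩ := Finset.exists_max_image (Finset.range p)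
    (fun t => (Finset.univ.filter fun i : Fin m => lvl i = t).card) hne
  have h := two_sq_le_of_smallBlocks N hN hnil B htop P lvl p hlvl hblock
    ((Finset.univ.filter fun i : Fin m => lvl i = t₀).card) (fun t ht => hmax t (Finset.mem_range.mpr ht))
  refine ⟨t₀, Finset.mem_range.mp ht₀, ?_⟩
  rw [Fintype.card_subtype]
  omega

end Summit.ValiantsHypothesis.ValiantsHypothesis.Theorems.GrenetZeon.KrylovSeed

end
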